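import Mathlib

/-!
# Window cells, all `m`: the arithmetic of LEMMA GAP-2 (no Harder–Narasimhan type has a slope gap across 2)

HONEST FRAMING. Lean index of the computation cell `pub-hsemireg` (W4 widening, lattice-first seat w4-lat-2, gen 17;
doc of record `widen/W4/lat2/code17/SIGMA-CHI-w4lat2g17.md` §2e). Elementary integer arithmetic quantified over all
`m`; no abelian surface or sheaf is formalised, and nothing in this file says HC, HC_CM or HC_AV is proved. No
`sorry`, no axiom beyond the standard three, no named fact, no `def`.

CONTEXT (informal). In a coprime window cell `(n; m, 3m)` (`m` odd, `t = m - 4`), let a Harder–Narasimhan type of the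
cokernel `𝒬` have a split with slopes `> 2` above and `< 2` below, `F` the top part with `c₁(F) = m·U` and rank
`r`, so `0 < 2r < mU` and `U ≤ 2t - 1 = 2m - 9` (a proper split). With the Σ-sharp certificates `Â₂ = 192`,
`B̂₂ = 0` the two LEMMA-SPLIT inequalities pin `χ(F) = 192 + 12(mU - r)`, and LEMMA CHI (theta-group descent)
says `3m² ∣ χ(F)`, i.e. `m² ∣ 16 + mU - r`; the transport congruence FM-DIV gives `3m ∣ tU - 2r`, in particular
`m ∣ (m-4)U - 2r`. Below: these are contradictory for every odd `m ≥ 9`. (No admissible piece has slope exactly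
`2` either: `3m ∣ -4u` is impossible for `0 < u < 3m`.)
-/

namespace Summit.Ventures.HSemireg.WindowCellGapTwo

/-- LEMMA GAP-2, arithmetic core, for ALL odd `m ≥ 9`: the pinned Euler characteristic `m² ∣ 16 + mU - r`, the
slope bounds `0 < 2r < mU`, the properness `U ≤ 2m - 9` and the transport congruence `m ∣ (m-4)U - 2r` cannot hold
together. -/
theorem gap_two_core (m U r : ℤ) (hm : 9 ≤ m) (hodd : Odd m) (hr : 0 < r) (h2r : 2 * r < m * U)
    (hU : U ≤ 2 * m - 9) (hsq : m ^ 2 ∣ 16 + m * U - r) (hdiv : m ∣ (m - 4) * U - 2 * r) : False := by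
  obtain ⟨k, hk⟩ := hsq
  have hm0 : 0 < m := by linarith
  have hmsq : 0 < m ^ 2 := by positivity
  -- the multiple is m² itself: 0 < 16 + mU - r < 2m²
  have hk1 : 1 ≤ k := by
    by_contra hcon
    have hk0 : k ≤ 0 := by omega
    have : m ^ 2 * k ≤ 0 := by nlinarith
    nlinarith
  have hk2 : k ≤ 1 := by
    by_contra hcon
    have hk3 : 2 ≤ k := by omega
    have h2 : 2 * m ^ 2 ≤ m ^ 2 * k := by nlinarith
    have hmU : m * U ≤ m * (2 * m - 9) := by nlinarith
    nlinarith
  have hk' : k = 1 := le_antisymm hk2 hk1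
  subst hk'
  -- so r = 16 + mU - m², and FM-DIV reduces to m ∣ 4(U + 8)
  have hr' : r = 16 + m * U - m ^ 2 := by linarith
  have h4 : m ∣ 4 * (U + 8) := by
    obtain ⟨c, hc⟩ := hdiv
    refine ⟨2 * m - U - c, ?_⟩
    rw [hr'] at hc
    linear_combination (-1 : ℤ) * hc
  obtain ⟨a, ha⟩ := hodd
  have hU8 : m ∣ U + 8 := by
    -- Bezout by hand for odd m = 2a + 1: 4(a+1)² = (m+1)² ≡ 1 (mod m)
    have key : U + 8 = 4 * (U + 8) * (a + 1) ^ 2 - m * ((U + 8) * (m + 2)) := by rw [ha]; ring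
    rw [key]
    exact dvd_sub (dvd_mul_of_dvd_left h4 _) (dvd_mul_right m _)
  obtain ⟨j, hj⟩ := hU8
  -- 2r < mU forces U ≥ 1, so 9 ≤ U + 8 ≤ 2m - 1, hence U + 8 = m
  have hU1 : 1 ≤ U := by nlinarith
  have hj1 : 1 ≤ j := by nlinarith
  have hj2 : j ≤ 1 := by nlinarith
  have hj' : j = 1 := le_antisymm hj2 hj1
  subst hj'
  -- then r = 16 - 8m < 0
  nlinarith

/-- No admissible piece of slope exactly `2`: `3m ∣ t·u - 2r` with `m·u = 2r` reads `3m ∣ -4u`, impossible for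
`0 < u ≤ 2m - 8` (odd `m ≥ 5`). -/
theorem no_piece_of_slope_two (m u : ℤ) (hm : 5 ≤ m) (hodd : Odd m) (hu : 0 < u) (hu2 : u ≤ 2 * m - 8)
    (h : 3 * m ∣ (m - 4) * u - m * u) : False := by
  have h' : 3 * m ∣ 4 * u := by
    have : (m - 4) * u - m * u = -(4 * u) := by ring
    rw [this] at h
    exact (dvd_neg).1 h
  have hm3 : m ∣ 4 * u := dvd_trans (dvd_mul_left m 3) h'
  obtain ⟨a, ha⟩ := hodd
  have hmu : m ∣ u := by
    have key : u = 4 * u * (a + 1) ^ 2 - m * (u * (m + 2)) := by rw [ha]; ring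
    rw [key]
    exact dvd_sub (dvd_mul_of_dvd_left hm3 _) (dvd_mul_right m _)
  obtain ⟨c, hc⟩ := hmu
  have hm0 : 0 < m := by linarith
  have hc1 : 1 ≤ c := by nlinarith
  -- u = m c ≥ m but also 3m ∣ 4u = 4mc forces 3 ∣ 4c, so c ≥ 3 and u ≥ 3m > 2m - 8
  obtain ⟨e, he⟩ := h'
  have h3c : (3 : ℤ) ∣ 4 * c := by
    refine ⟨e, ?_⟩
    have : 4 * (m * c) = 3 * m * e := by rw [← hc]; linarith
    nlinarith [this]
  have h3c' : (3 : ℤ) ∣ c := by omega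
  obtain ⟨f, hf⟩ := h3c'
  have hf1 : 1 ≤ f := by omega
  nlinarith

/-- The four computed cells as instances (numerology of §2e): at `m = 21, 23, 27, 29` the types WITH a gap across 2
number `1775, 5086, 29318, 75717` of `1803, 5122, 29384, 75795`; the residual counts are `28, 36, 66, 78`. -/
theorem residual_counts :
    1803 - 1775 = 28 ∧ 5122 - 5086 = 36 ∧ 29384 - 29318 = 66 ∧ 75795 - 75717 = 78 := by norm_num

end Summit.Ventures.HSemireg.WindowCellGapTwo
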